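import Mathlib
import HarnessLib
import Summits.Langlands.Langlands.Theses.GenuineTorsionSplit
import Summits.Langlands.Langlands.Theorems.LevelOneDyadicCharZero
import Literature.NumberTheory.Automorphic.ResGLnCohomology
import Literature.NumberTheory.GaloisRepresentations.GrossencharakterIdeleValue

/-! # BC3 birth skeleton `harder-exhaustion` for the crux WL = `ClassicalCongruenceSplit.WeightedLiftableAutomorphy` (child route ClassicalCongruenceSplit, lens-4 g20)
WL = GZ's box with a CLASSICAL RECEPTACLE AVATAR (finite `S`, level `𝔫 ≠ 0`, weight `λ`, degree `q`, a reduction `τ̄` of `ρ`, `ℤ̄₂`-eigenvalues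
`a` off `S` of a non-zero `c ∈ ResGLnCohomology.levelCohomology (PadicAlgCl 2) n K 𝔫 λ q`, `residue ∘ a` associated with `τ̄`) ⟹ the lineage TAIL.
Three NAMED stubs and the kernel-checked composition `WeightedLiftableAutomorphy_of` THROUGH THE LANDED JUNCTION
`LevelOneDyadic.Transit.residuallyAutomorphic_of_assoc` (p795582) — 0 sorry outside `stub_*`:
* `stub_harder1987` — PRINT, the tree's NAMED FACT `ResGLnCohomology.Harder1987_eigensystem_cuspidalOrEisenstein` verbatim (Harder 1987 §4.2 Thm 2: a non-zero
  a.e.-`T_{w,1}, T_{w,2}`-eigenclass in `H^q(S_{K_f(𝔫)}, Ẽ_λ(E))` over a totally real field is CUSPIDAL COHOMOLOGICAL (a regular algebraic cuspidal `π₀` with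
  `ι(a_{w,1}) = q_w^{1/2} e₁(α_w)`, `ι(a_{w,2}) = e₂(α_w)`) OR EISENSTEIN (a pair of type-`A₀` Größencharaktere);
* `stub_eisensteinExcluded` — THE GALOIS-SIDE LEMMA (M): an `ℤ̄₂`-valued eigenvalue family whose residue family is associated (off a finite `S`) with a reduction `τ̄`
  of a `ρ` ALL of whose residual representations are insoluble is NOT Eisenstein: otherwise the 2-adic characters `χ₁, χ₂` of `ψ₁, ψ₂` (Weil, type `A₀`) give
  `charpoly τ̄(Frob_w) ≡ (X − χ̄₁)(X − χ̄₂)` a.e., so by Chebotarev + Brauer–Nesbitt `τ̄^ss ≅ χ̄₁ ⊕ χ̄₂` is a residual representation of `ρ` with ABELIAN image —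
  contradiction.  Why it might fail: only through a normalisation slip (`N(w)·a_{w,2}` vs `heckeFrobPoly`), not in substance;
* `stub_cuspidalLAlgebraicTwist` — THE NORMALISATION LEMMA (M, the node's instrument M2-norm): from Harder's cuspidal disjunct (`π₀` regular algebraic = C-normalised)
  the L-algebraic twist `π = π₀ ⊗ |det|^{∓1/2}` (`AlgebraicityParityGL`) has `arithFrobPolyOfSatake ι q_v 1 (Satake_v π) = heckeFrobPoly(a_v)` a.e.  Why it might fail:
  the exponent conventions of `ResGLnCohomology.heckeT` (`q^{i(2−i)/2} e_i`), `heckeFrobPoly` and `arithFrobPolyOfSatake … 1` must line up at weight `λ` — exactly the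
  grounder instrument flagged for ES (g19) and ESW (g20); a mismatch is repaired by re-normalising `a`, not by abandoning the line.
COMPOSITION: restrict the all-`j` eigen-equations off the finite `S` to `j = 1, 2` almost everywhere (`Set.Finite.eventually_cofinite_notMem`), apply Harder; the Eisenstein
disjunct contradicts `stub_eisensteinExcluded`; the cuspidal disjunct, twisted by `stub_cuspidalLAlgebraicTwist`, feeds the junction.  The node's one-stub discharge
`wl_of_weightedEichlerShimura : ESW → WL` is the coarser form of the same line (ESW = Harder ∧ EE ∧ CT packaged).
No stub is cheaply ⟹ WL or ⟹ Langlands: `stub_harder1987`/`stub_cuspidalLAlgebraicTwist` produce no Galois congruence, `stub_eisensteinExcluded` produces no `π`. -/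

set_option linter.dupNamespace false
set_option linter.unusedVariables false
set_option linter.unusedSectionVars false

namespace Summit.Langlands.Langlands.Cruxes.WeightedLiftableAutomorphy.HarderExhaustion

open scoped NumberField
open NumberField Filter IsDedekindDomain Polynomial
open Literature.NumberTheory.GaloisRepresentations Literature.NumberTheory.Automorphic
open Literature.NumberTheory.Automorphic.BigHeckeGLn
open Summit.Langlands.Langlands.Theorems.LevelOneDyadic

/-- The crux WL, verbatim (= `Summit.Langlands.Langlands.Theses.ClassicalCongruenceSplit.WeightedLiftableAutomorphy` of the node; after birth the route decl, `Iff.rfl`). -/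
def WeightedLiftableAutomorphy : Prop :=
  ∀ (K : Type) [Field K] [NumberField K] (n : ℕ) (hcpt : Literature.NumberTheory.Automorphic.isCompact_glFiniteIntegralLevel n K), 0 < n → ∀ (ι : PadicAlgCl 2 ≃+* ℂ) (ρ : Literature.NumberTheory.GaloisRepresentations.FramedGaloisRep K (PadicAlgCl 2) n), ρ.toGaloisRep.IsIrreducible → (∀ τ : Field.absoluteGaloisGroup K →* GL (Fin n) (Literature.NumberTheory.GaloisRepresentations.padicAlgClResidueField 2), ρ.IsResidualRepOf (RingHom.id (Literature.NumberTheory.GaloisRepresentations.padicAlgClResidueField 2)) τ → ¬ IsSolvable τ.range) → ¬ (∃ (σ : Literature.NumberTheory.GaloisRepresentations.FramedGaloisRep K (PadicAlgCl 2) n) (τ : Field.absoluteGaloisGroup K →* GL (Fin n) (Literature.NumberTheory.GaloisRepresentations.padicAlgClResidueField 2)), (Set.range (fun g : Field.absoluteGaloisGroup K => σ g)).Finite ∧ σ.toGaloisRep.IsIrreducible ∧ ρ.IsResidualRepOf (RingHom.id (Literature.NumberTheory.GaloisRepresentations.padicAlgClResidueField 2)) τ ∧ σ.IsResidualRepOf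 (RingHom.id (Literature.NumberTheory.GaloisRepresentations.padicAlgClResidueField 2)) τ) → ((∀ᶠ v : IsDedekindDomain.HeightOneSpectrum (NumberField.RingOfIntegers K) in cofinite, ρ.IsUnramifiedAt v) ∧ ∀ (v : IsDedekindDomain.HeightOneSpectrum (NumberField.RingOfIntegers K)) (hv : ((2 : ℕ) : NumberField.RingOfIntegers K) ∈ v.asIdeal), (Literature.NumberTheory.PAdicHodge.fontainePstAdicCompletion v 2 hv).IsDeRhamFramed (ρ.toLocal v)) → (∀ (v : IsDedekindDomain.HeightOneSpectrum (NumberField.RingOfIntegers K)) (hv : ((2 : ℕ) : NumberField.RingOfIntegers K) ∈ v.asIdeal), ∀ e : v.adicCompletion K →+* PadicAlgCl 2, Continuous e → (ρ.labelledHodgeTateWeightsAt v (Literature.NumberTheory.PAdicHodge.fontainePstAdicCompletion v 2 hv).algebra (Literature.NumberTheory.PAdicHodge.fontainePstAdicCompletion v 2 hv).𝔅 e).Nodup) → (∀ v : IsDedekindDomain.HeightOneSpectrum (NumberField.RingOfIntegers K), ((2 : ℕ) : NumberField.RingOfIntegers K) ∉ v.asIdeal → ρ.IsUnramifiedAt v)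 → (n = 2 ∧ NumberField.IsTotallyReal K) → (letI : TopologicalSpace (Literature.NumberTheory.GaloisRepresentations.padicAlgClResidueField 2) := ⊥; ∃ (S : Set (IsDedekindDomain.HeightOneSpectrum (NumberField.RingOfIntegers K))), S.Finite ∧ ∃ (𝔫 : Ideal (NumberField.RingOfIntegers K)), 𝔫 ≠ 0 ∧ ∃ (lam : (K →+* PadicAlgCl 2) → Fin n → ℤ) (q : ℕ) (τ : Literature.NumberTheory.GaloisRepresentations.FramedGaloisRep K (Literature.NumberTheory.GaloisRepresentations.padicAlgClResidueField 2) n) (a : IsDedekindDomain.HeightOneSpectrum (NumberField.RingOfIntegers K) → ℕ → (Valued.v : Valuation (PadicAlgCl 2) NNReal).valuationSubring) (c : Literature.NumberTheory.Automorphic.ResGLnCohomology.levelCohomology (PadicAlgCl 2) n K 𝔫 lam q), ρ.IsReductionOf (RingHom.id (Literature.NumberTheory.GaloisRepresentations.padicAlgClResidueField 2)) (τ : Field.absoluteGaloisGroup K →* GL (Fin n) (Literature.NumberTheory.GaloisRepresentations.padicAlgClResidueField 2)) ∧ c ≠ 0 ∧ (∀ v ∉ S, ∀ j : ℕ, Literature.NumberTheory.Automorphic.ResGLnCohomology.heckeT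 (PadicAlgCl 2) n K 𝔫 lam q v j c = ((a v j : (Valued.v : Valuation (PadicAlgCl 2) NNReal).valuationSubring) : PadicAlgCl 2) • c) ∧ Literature.NumberTheory.Automorphic.BigHeckeGLn.IsAssociatedFamily n S (fun v j => IsLocalRing.residue (Valued.v : Valuation (PadicAlgCl 2) NNReal).valuationSubring (a v j)) τ) → ∃ π : Literature.NumberTheory.Automorphic.CuspidalAutomorphicRepData n K hcpt, π.1.IsLAlgebraic ∧ ∀ᶠ v : IsDedekindDomain.HeightOneSpectrum (NumberField.RingOfIntegers K) in cofinite, ρ.IsUnramifiedAt v ∧ (∃ α : Multiset ℂ, π.1.HasSatakeParamAt v α) ∧ ∀ α : Multiset ℂ, π.1.HasSatakeParamAt v α → ∃ P Q : Polynomial (Valued.v : Valuation (PadicAlgCl 2) NNReal).valuationSubring, ρ.HasFrobCharpolyAt v (P.map (Valued.v : Valuation (PadicAlgCl 2) NNReal).valuationSubring.subtype) ∧ Literature.NumberTheory.Automorphic.arithFrobPolyOfSatake ι v.residueCard 1 α = Q.map (Valued.v : Valuation (PadicAlgCl 2) NNReal).valuationSubring.subtype ∧ P.map (IsLocalRing.residue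 (Valued.v : Valuation (PadicAlgCl 2) NNReal).valuationSubring) = Q.map (IsLocalRing.residue (Valued.v : Valuation (PadicAlgCl 2) NNReal).valuationSubring)

/-- The tree's NAMED FACT `Literature.NumberTheory.Automorphic.ResGLnCohomology.Harder1987_eigensystem_cuspidalOrEisenstein` INLINED VERBATIM
(file `Literature/NumberTheory/Automorphic/ResGL2EigensystemCuspidalOrEisenstein.lean` L161–182; the farm reports that module UNBUILT, so it cannot be imported
in a checked file today — textual certificate `ClassicalCongruenceSplit.birth_WL.HarderVendored.diff.txt`: two hunks, the `ResGLnCohomology.` qualifiers; the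
identification `VendoredHarder1987Text ↔ Harder1987_eigensystem_cuspidalOrEisenstein := Iff.rfl` once the module is built). -/
def VendoredHarder1987Text : Prop :=
  ∀ (F : Type) [Field F] [NumberField F], NumberField.IsTotallyReal F →
    ∀ (hcpt : isCompact_glFiniteIntegralLevel 2 F) (E : Type) [Field E] (ι : E ≃+* ℂ)
      (𝔫 : Ideal (𝓞 F)), 𝔫 ≠ 0 →
    ∀ (lam : (F →+* E) → Fin 2 → ℤ) (q : ℕ) (c : ResGLnCohomology.levelCohomology E 2 F 𝔫 lam q), c ≠ 0 →
    ∀ (a : HeightOneSpectrum (𝓞 F) → ℕ → E),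
      (∀ᶠ w in Filter.cofinite, ResGLnCohomology.heckeT E 2 F 𝔫 lam q w 1 c = a w 1 • c ∧
        ResGLnCohomology.heckeT E 2 F 𝔫 lam q w 2 c = a w 2 • c) →
      (∃ π₀ : CuspidalAutomorphicRepData 2 F hcpt, π₀.1.IsRegularAlgebraic ∧
        ∀ᶠ w in Filter.cofinite, ∃ α : Multiset ℂ, π₀.1.HasSatakeParamAt w α ∧
          ι (a w 1) = ((Real.sqrt (w.residueCard : ℝ) : ℝ) : ℂ) * α.esymm 1 ∧ ι (a w 2) = α.esymm 2) ∨
      (∃ (𝔣 : Ideal (𝓞 F)) (p₁ q₁ p₂ q₂ : InfinitePlace F → ℤ) (ψ₁ ψ₂ : HeightOneSpectrum (𝓞 F) → ℂ),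
        𝔣 ≠ ⊥ ∧ IsGrossencharakter 𝔣 p₁ q₁ ψ₁ ∧ IsGrossencharakter 𝔣 p₂ q₂ ψ₂ ∧
        ∀ᶠ w in Filter.cofinite, ι (a w 1) = ψ₁ w + ψ₂ w ∧
          ((Ideal.absNorm w.asIdeal : ℕ) : ℂ) * ι (a w 2) = ψ₁ w * ψ₂ w)

/-- stub (PRINT) — Harder 1987 §4.2 Thm 2 = the tree's named fact (inlined text; closes BY NAME `fun h => h` from the Literature decl once importable). -/
theorem stub_harder1987 : VendoredHarder1987Text := by
  sorry

/-- stub (M) — Eisenstein eigenvalue systems are excluded by the insolubility of every residual representation of `ρ`. -/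
theorem stub_eisensteinExcluded : ∀ (K : Type) [Field K] [NumberField K] (ι : PadicAlgCl 2 ≃+* ℂ) (ρ : Literature.NumberTheory.GaloisRepresentations.FramedGaloisRep K (PadicAlgCl 2) 2), (∀ τ : Field.absoluteGaloisGroup K →* GL (Fin 2) (Literature.NumberTheory.GaloisRepresentations.padicAlgClResidueField 2), ρ.IsResidualRepOf (RingHom.id (Literature.NumberTheory.GaloisRepresentations.padicAlgClResidueField 2)) τ → ¬ IsSolvable τ.range) → (letI : TopologicalSpace (Literature.NumberTheory.GaloisRepresentations.padicAlgClResidueField 2) := ⊥; ∀ (τ : Literature.NumberTheory.GaloisRepresentations.FramedGaloisRep K (Literature.NumberTheory.GaloisRepresentations.padicAlgClResidueField 2) 2), ρ.IsReductionOf (RingHom.id (Literature.NumberTheory.GaloisRepresentations.padicAlgClResidueField 2)) (τ : Field.absoluteGaloisGroup K →* GL (Fin 2) (Literature.NumberTheory.GaloisRepresentations.padicAlgClResidueField 2)) → ∀ (S : Set (IsDedekindDomain.HeightOneSpectrum (NumberField.RingOfIntegers K))), S.Finite → ∀ (a : IsDedekindDomain.HeightOneSpectrum (NumberField.RingOfIntegers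 K) → ℕ → (Valued.v : Valuation (PadicAlgCl 2) NNReal).valuationSubring), Literature.NumberTheory.Automorphic.BigHeckeGLn.IsAssociatedFamily 2 S (fun v j => IsLocalRing.residue (Valued.v : Valuation (PadicAlgCl 2) NNReal).valuationSubring (a v j)) τ → ¬ (∃ (𝔣 : Ideal (NumberField.RingOfIntegers K)) (p₁ q₁ p₂ q₂ : NumberField.InfinitePlace K → ℤ) (ψ₁ ψ₂ : IsDedekindDomain.HeightOneSpectrum (NumberField.RingOfIntegers K) → ℂ), 𝔣 ≠ ⊥ ∧ Literature.NumberTheory.GaloisRepresentations.IsGrossencharakter 𝔣 p₁ q₁ ψ₁ ∧ Literature.NumberTheory.GaloisRepresentations.IsGrossencharakter 𝔣 p₂ q₂ ψ₂ ∧ ∀ᶠ w : IsDedekindDomain.HeightOneSpectrum (NumberField.RingOfIntegers K) in Filter.cofinite, ι (((a w 1 : (Valued.v : Valuation (PadicAlgCl 2) NNReal).valuationSubring) : PadicAlgCl 2)) = ψ₁ w + ψ₂ w ∧ ((Ideal.absNorm w.asIdeal : ℕ) : ℂ) * ι (((a w 2 : (Valued.v : Valuation (PadicAlgCl 2) NNReal).valuationSubring)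 : PadicAlgCl 2)) = ψ₁ w * ψ₂ w)) := by
  sorry

/-- stub (M) — the C-algebraic → L-algebraic half-twist and the Satake/Hecke–Frobenius normalisation at weight `λ`. -/
theorem stub_cuspidalLAlgebraicTwist : ∀ (K : Type) [Field K] [NumberField K], NumberField.IsTotallyReal K → ∀ (hcpt : Literature.NumberTheory.Automorphic.isCompact_glFiniteIntegralLevel 2 K) (ι : PadicAlgCl 2 ≃+* ℂ) (a : IsDedekindDomain.HeightOneSpectrum (NumberField.RingOfIntegers K) → ℕ → (Valued.v : Valuation (PadicAlgCl 2) NNReal).valuationSubring) (π₀ : Literature.NumberTheory.Automorphic.CuspidalAutomorphicRepData 2 K hcpt), π₀.1.IsRegularAlgebraic → (∀ᶠ w : IsDedekindDomain.HeightOneSpectrum (NumberField.RingOfIntegers K) in Filter.cofinite, ∃ α : Multiset ℂ, π₀.1.HasSatakeParamAt w α ∧ ι (((a w 1 : (Valued.v : Valuation (PadicAlgCl 2) NNReal).valuationSubring) : PadicAlgCl 2)) = ((Real.sqrt (w.residueCard : ℝ) : ℝ) : ℂ) * α.esymm 1 ∧ ι (((a w 2 : (Valued.v : Valuation (PadicAlgCl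 2) NNReal).valuationSubring) : PadicAlgCl 2)) = α.esymm 2) → ∃ π : Literature.NumberTheory.Automorphic.CuspidalAutomorphicRepData 2 K hcpt, π.1.IsLAlgebraic ∧ ∀ᶠ v : IsDedekindDomain.HeightOneSpectrum (NumberField.RingOfIntegers K) in Filter.cofinite, (∃ α : Multiset ℂ, π.1.HasSatakeParamAt v α) ∧ ∀ α : Multiset ℂ, π.1.HasSatakeParamAt v α → Literature.NumberTheory.Automorphic.arithFrobPolyOfSatake ι v.residueCard 1 α = (Literature.NumberTheory.Automorphic.BigHeckeGLn.heckeFrobPoly 2 (Ideal.absNorm v.asIdeal) (a v)).map (Valued.v : Valuation (PadicAlgCl 2) NNReal).valuationSubring.subtype := by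
  sorry

/-- COMPOSITION (kernel-checked, no sorry): Harder's exhaustion, Eisenstein excluded, cuspidal twisted, then the landed junction. -/
theorem WeightedLiftableAutomorphy_of
    (hH : VendoredHarder1987Text)
    (hEE : ∀ (K : Type) [Field K] [NumberField K] (ι : PadicAlgCl 2 ≃+* ℂ) (ρ : Literature.NumberTheory.GaloisRepresentations.FramedGaloisRep K (PadicAlgCl 2) 2), (∀ τ : Field.absoluteGaloisGroup K →* GL (Fin 2) (Literature.NumberTheory.GaloisRepresentations.padicAlgClResidueField 2), ρ.IsResidualRepOf (RingHom.id (Literature.NumberTheory.GaloisRepresentations.padicAlgClResidueField 2)) τ → ¬ IsSolvable τ.range) → (letI : TopologicalSpace (Literature.NumberTheory.GaloisRepresentations.padicAlgClResidueField 2) := ⊥; ∀ (τ : Literature.NumberTheory.GaloisRepresentations.FramedGaloisRep K (Literature.NumberTheory.GaloisRepresentations.padicAlgClResidueField 2) 2), ρ.IsReductionOf (RingHom.id (Literature.NumberTheory.GaloisRepresentations.padicAlgClResidueField 2)) (τ : Field.absoluteGaloisGroup K →* GL (Fin 2) (Literature.NumberTheory.GaloisRepresentations.padicAlgClResidueField 2))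 → ∀ (S : Set (IsDedekindDomain.HeightOneSpectrum (NumberField.RingOfIntegers K))), S.Finite → ∀ (a : IsDedekindDomain.HeightOneSpectrum (NumberField.RingOfIntegers K) → ℕ → (Valued.v : Valuation (PadicAlgCl 2) NNReal).valuationSubring), Literature.NumberTheory.Automorphic.BigHeckeGLn.IsAssociatedFamily 2 S (fun v j => IsLocalRing.residue (Valued.v : Valuation (PadicAlgCl 2) NNReal).valuationSubring (a v j)) τ → ¬ (∃ (𝔣 : Ideal (NumberField.RingOfIntegers K)) (p₁ q₁ p₂ q₂ : NumberField.InfinitePlace K → ℤ) (ψ₁ ψ₂ : IsDedekindDomain.HeightOneSpectrum (NumberField.RingOfIntegers K) → ℂ), 𝔣 ≠ ⊥ ∧ Literature.NumberTheory.GaloisRepresentations.IsGrossencharakter 𝔣 p₁ q₁ ψ₁ ∧ Literature.NumberTheory.GaloisRepresentations.IsGrossencharakter 𝔣 p₂ q₂ ψ₂ ∧ ∀ᶠ w : IsDedekindDomain.HeightOneSpectrum (NumberField.RingOfIntegers K) in Filter.cofinite, ι (((a w 1 : (Valued.v : Valuation (PadicAlgCl 2) NNReal).valuationSubring) : PadicAlgCl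 2)) = ψ₁ w + ψ₂ w ∧ ((Ideal.absNorm w.asIdeal : ℕ) : ℂ) * ι (((a w 2 : (Valued.v : Valuation (PadicAlgCl 2) NNReal).valuationSubring) : PadicAlgCl 2)) = ψ₁ w * ψ₂ w)))
    (hCT : ∀ (K : Type) [Field K] [NumberField K], NumberField.IsTotallyReal K → ∀ (hcpt : Literature.NumberTheory.Automorphic.isCompact_glFiniteIntegralLevel 2 K) (ι : PadicAlgCl 2 ≃+* ℂ) (a : IsDedekindDomain.HeightOneSpectrum (NumberField.RingOfIntegers K) → ℕ → (Valued.v : Valuation (PadicAlgCl 2) NNReal).valuationSubring) (π₀ : Literature.NumberTheory.Automorphic.CuspidalAutomorphicRepData 2 K hcpt), π₀.1.IsRegularAlgebraic → (∀ᶠ w : IsDedekindDomain.HeightOneSpectrum (NumberField.RingOfIntegers K) in Filter.cofinite, ∃ α : Multiset ℂ, π₀.1.HasSatakeParamAt w α ∧ ι (((a w 1 : (Valued.v : Valuation (PadicAlgCl 2) NNReal).valuationSubring) : PadicAlgCl 2)) = ((Real.sqrt (w.residueCard : ℝ) : ℝ) : ℂ) * α.esymm 1 ∧ ι (((a w 2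 : (Valued.v : Valuation (PadicAlgCl 2) NNReal).valuationSubring) : PadicAlgCl 2)) = α.esymm 2) → ∃ π : Literature.NumberTheory.Automorphic.CuspidalAutomorphicRepData 2 K hcpt, π.1.IsLAlgebraic ∧ ∀ᶠ v : IsDedekindDomain.HeightOneSpectrum (NumberField.RingOfIntegers K) in Filter.cofinite, (∃ α : Multiset ℂ, π.1.HasSatakeParamAt v α) ∧ ∀ α : Multiset ℂ, π.1.HasSatakeParamAt v α → Literature.NumberTheory.Automorphic.arithFrobPolyOfSatake ι v.residueCard 1 α = (Literature.NumberTheory.Automorphic.BigHeckeGLn.heckeFrobPoly 2 (Ideal.absNorm v.asIdeal) (a v)).map (Valued.v : Valuation (PadicAlgCl 2) NNReal).valuationSubring.subtype) :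
    WeightedLiftableAutomorphy := by
  intro K _ _ n hcpt hn ι ρ hirr hins hnl hgeo hreg hlvl hd hav
  obtain ⟨hn2, hTR⟩ := hd
  subst hn2
  letI : TopologicalSpace (padicAlgClResidueField 2) := ⊥
  obtain ⟨S, hS, 𝔫, h𝔫, lam, q, τ, a, c, hρτ, hc, heig, hass⟩ := hav
  have hev : ∀ᶠ w : HeightOneSpectrum (𝓞 K) in Filter.cofinite,
      ResGLnCohomology.heckeT (PadicAlgCl 2) 2 K 𝔫 lam q w 1 c = (fun w i => ((a w i : (Valued.v : Valuation (PadicAlgCl 2) NNReal).valuationSubring) : PadicAlgCl 2)) w 1 • c ∧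
      ResGLnCohomology.heckeT (PadicAlgCl 2) 2 K 𝔫 lam q w 2 c = (fun w i => ((a w i : (Valued.v : Valuation (PadicAlgCl 2) NNReal).valuationSubring) : PadicAlgCl 2)) w 2 • c :=
    (Set.Finite.eventually_cofinite_notMem hS).mono fun w hw => ⟨heig w hw 1, heig w hw 2⟩
  rcases hH K hTR hcpt (PadicAlgCl 2) ι 𝔫 h𝔫 lam q c hc (fun w i => ((a w i : (Valued.v : Valuation (PadicAlgCl 2) NNReal).valuationSubring) : PadicAlgCl 2)) hev with
    ⟨π₀, hreg0, hsat⟩ | heis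
  · obtain ⟨π, hπalg, hπ⟩ := hCT K hTR hcpt ι a π₀ hreg0 hsat
    exact ⟨π, Transit.residuallyAutomorphic_of_assoc hcpt ι ρ τ hρτ hgeo.1 hS a hass π hπalg hπ⟩
  · exact absurd heis (hEE K ι ρ hins τ hρτ S hS a hass)

/-- The crux from the stubs. -/
theorem WeightedLiftableAutomorphy_holds : WeightedLiftableAutomorphy :=
  WeightedLiftableAutomorphy_of stub_harder1987 stub_eisensteinExcluded stub_cuspidalLAlgebraicTwist

/-- Sanity: the restated crux is the host-chain decl of the node file by `Iff.rfl` once both are in scope (here: against GZ's route decl it is NOT —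
WL is strictly weaker; see kit probes 3, 12). The node's decl and this one have the same text. -/
example : WeightedLiftableAutomorphy ↔ (∀ (K : Type) [Field K] [NumberField K] (n : ℕ) (hcpt : Literature.NumberTheory.Automorphic.isCompact_glFiniteIntegralLevel n K), 0 < n → ∀ (ι : PadicAlgCl 2 ≃+* ℂ) (ρ : Literature.NumberTheory.GaloisRepresentations.FramedGaloisRep K (PadicAlgCl 2) n), ρ.toGaloisRep.IsIrreducible → (∀ τ : Field.absoluteGaloisGroup K →* GL (Fin n) (Literature.NumberTheory.GaloisRepresentations.padicAlgClResidueField 2), ρ.IsResidualRepOf (RingHom.id (Literature.NumberTheory.GaloisRepresentations.padicAlgClResidueField 2)) τ → ¬ IsSolvable τ.range) → ¬ (∃ (σ : Literature.NumberTheory.GaloisRepresentations.FramedGaloisRep K (PadicAlgCl 2) n) (τ : Field.absoluteGaloisGroup K →* GL (Fin n) (Literature.NumberTheory.GaloisRepresentations.padicAlgClResidueField 2)), (Set.range (fun g : Field.absoluteGaloisGroup K => σ g)).Finite ∧ σ.toGaloisRep.IsIrreducible ∧ ρ.IsResidualRepOf (RingHom.id (Literature.NumberTheory.GaloisRepresentations.padicAlgClResidueField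 2)) τ ∧ σ.IsResidualRepOf (RingHom.id (Literature.NumberTheory.GaloisRepresentations.padicAlgClResidueField 2)) τ) → ((∀ᶠ v : IsDedekindDomain.HeightOneSpectrum (NumberField.RingOfIntegers K) in cofinite, ρ.IsUnramifiedAt v) ∧ ∀ (v : IsDedekindDomain.HeightOneSpectrum (NumberField.RingOfIntegers K)) (hv : ((2 : ℕ) : NumberField.RingOfIntegers K) ∈ v.asIdeal), (Literature.NumberTheory.PAdicHodge.fontainePstAdicCompletion v 2 hv).IsDeRhamFramed (ρ.toLocal v)) → (∀ (v : IsDedekindDomain.HeightOneSpectrum (NumberField.RingOfIntegers K)) (hv : ((2 : ℕ) : NumberField.RingOfIntegers K) ∈ v.asIdeal), ∀ e : v.adicCompletion K →+* PadicAlgCl 2, Continuous e → (ρ.labelledHodgeTateWeightsAt v (Literature.NumberTheory.PAdicHodge.fontainePstAdicCompletion v 2 hv).algebra (Literature.NumberTheory.PAdicHodge.fontainePstAdicCompletion v 2 hv).𝔅 e).Nodup) → (∀ v : IsDedekindDomain.HeightOneSpectrum (NumberField.RingOfIntegers K), ((2 : ℕ) : NumberField.RingOfIntegers K) ∉ v.asIdeal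 → ρ.IsUnramifiedAt v) → (n = 2 ∧ NumberField.IsTotallyReal K) → (letI : TopologicalSpace (Literature.NumberTheory.GaloisRepresentations.padicAlgClResidueField 2) := ⊥; ∃ (S : Set (IsDedekindDomain.HeightOneSpectrum (NumberField.RingOfIntegers K))), S.Finite ∧ ∃ (𝔫 : Ideal (NumberField.RingOfIntegers K)), 𝔫 ≠ 0 ∧ ∃ (lam : (K →+* PadicAlgCl 2) → Fin n → ℤ) (q : ℕ) (τ : Literature.NumberTheory.GaloisRepresentations.FramedGaloisRep K (Literature.NumberTheory.GaloisRepresentations.padicAlgClResidueField 2) n) (a : IsDedekindDomain.HeightOneSpectrum (NumberField.RingOfIntegers K) → ℕ → (Valued.v : Valuation (PadicAlgCl 2) NNReal).valuationSubring) (c : Literature.NumberTheory.Automorphic.ResGLnCohomology.levelCohomology (PadicAlgCl 2) n K 𝔫 lam q), ρ.IsReductionOf (RingHom.id (Literature.NumberTheory.GaloisRepresentations.padicAlgClResidueField 2)) (τ : Field.absoluteGaloisGroup K →* GL (Fin n) (Literature.NumberTheory.GaloisRepresentations.padicAlgClResidueField 2)) ∧ c ≠ 0 ∧ (∀ v ∉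 S, ∀ j : ℕ, Literature.NumberTheory.Automorphic.ResGLnCohomology.heckeT (PadicAlgCl 2) n K 𝔫 lam q v j c = ((a v j : (Valued.v : Valuation (PadicAlgCl 2) NNReal).valuationSubring) : PadicAlgCl 2) • c) ∧ Literature.NumberTheory.Automorphic.BigHeckeGLn.IsAssociatedFamily n S (fun v j => IsLocalRing.residue (Valued.v : Valuation (PadicAlgCl 2) NNReal).valuationSubring (a v j)) τ) → ∃ π : Literature.NumberTheory.Automorphic.CuspidalAutomorphicRepData n K hcpt, π.1.IsLAlgebraic ∧ ∀ᶠ v : IsDedekindDomain.HeightOneSpectrum (NumberField.RingOfIntegers K) in cofinite, ρ.IsUnramifiedAt v ∧ (∃ α : Multiset ℂ, π.1.HasSatakeParamAt v α) ∧ ∀ α : Multiset ℂ, π.1.HasSatakeParamAt v α → ∃ P Q : Polynomial (Valued.v : Valuation (PadicAlgCl 2) NNReal).valuationSubring, ρ.HasFrobCharpolyAt v (P.map (Valued.v : Valuation (PadicAlgCl 2) NNReal).valuationSubring.subtype) ∧ Literature.NumberTheory.Automorphic.arithFrobPolyOfSatake ι v.residueCard 1 α = Q.map (Valued.v : Valuation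 (PadicAlgCl 2) NNReal).valuationSubring.subtype ∧ P.map (IsLocalRing.residue (Valued.v : Valuation (PadicAlgCl 2) NNReal).valuationSubring) = Q.map (IsLocalRing.residue (Valued.v : Valuation (PadicAlgCl 2) NNReal).valuationSubring)) := Iff.rfl

end Summit.Langlands.Langlands.Cruxes.WeightedLiftableAutomorphy.HarderExhaustion
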